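import Literature.ModelTheory.Quasiminimal.ClassCrowns
import HarnessLib

/-!
# Uniqueness of large models in a quasiminimal pregeometry class (Kirby 2010, Thm 3.3; Haykazyan 2016, Thm 16)

J. Kirby, *On quasiminimal excellent classes*, J. Symbolic Logic 75 (2010), Thm 3.3 and
Cor. 3.4: in a quasiminimal excellent class, a bijection between bases of two members extends
to an isomorphism; models are determined up to isomorphism by their dimension. M. Bays, B. Hart,
T. Hyttinen, M. Kesälä, J. Kirby, Bull. LMS 46 (2014), Thm 2.3: the excellence axiom follows
from the others, so the same holds in every quasiminimal pregeometry class — L. Haykazyan,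
J. Symbolic Logic 81 (2016), Thm 16, for the classes of his Def. 2
(`IsQuasiminimalPregeometryClass`), of which he gives a direct proof with the same skeleton.

We formalise Kirby's proof of Thm 3.3 for Haykazyan's classes, with excellence supplied by
BHHKK's Prop. 6.2 through `CrownEmbeddings.lean` / `ClassCrowns.lean`:

* the data of the proof (`KirbyData`: independent sets `B ⊆ H`, `B' ⊆ H'`, a map `e` injective on
  `B` into `B'`, an injective sequence `u` in `B` with `B₀ = range u`, and a closed embedding
  `f₀` of `cl B₀` onto `cl (e[B₀])` extending `e`), and the compatible family of closed
  embeddings `f_X : cl (B₀ ∪ X) → H'`, `X ⊆ B ∖ B₀` finite, extending `f₀ ∪ e|X` (`GoodAt`);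
* `KirbyData.exists_swap` — the automorphism of `cl (D ∪ {a, z})` over the closed countable `D`
  swapping two points generic over `D` (Kirby: "an automorphism `σ` of `H₀`, fixing
  `cl_H(G₀ Y_k)` and swapping `x_k` and `z`", from Thm 2.1);
* `KirbyData.eqQFType₂_append_of_fixed` — the heart of Kirby's induction on `k`
  (p. 7 of the source): a partial embedding `φ` of the face `F_k = cl (B₀ ∪ X ∖ {x_k})` which is
  the identity on `cl B₀`, on `X ∖ {x_k}` and on the previous faces `F_i ∩ F_k` does not change
  quantifier-free types over the previous faces: `qftp(ā, c̄) = qftp(ā, φ c̄)` for `ā` in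
  `⋃_{i} F_i`, `c̄` in `F_k` — proved with the swap `σ` and a generic `z ∈ B₀`;
* `KirbyData.exists_goodAt_extend` — the amalgamation step: given compatible `f_Y` for the proper
  subsets `Y ⊊ X` (`|X| ≥ 2`), their union `g_X` on the crown `⋃ᵢ cl (B₀ ∪ Yᵢ)` is a partial
  embedding (induction on `k` as above, after pulling back along an isomorphism
  `ε_X : cl (B₀ ∪ X) ≅ cl (e[B₀] ∪ e[X])` from Thm 2.1 so that all maps become partial
  self-embeddings of `H` fixing the basis, and `ClassCrowns.lean` at each stage), and extends to
  `f_X` (Kirby's Lemma 3.2, again `ClassCrowns.lean`);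
* `KirbyData.exists_goodFamily` — the recursion over finite subsets of `B ∖ B₀` by cardinality;
* `IsQuasiminimalPregeometryClass.exists_equiv_extend_bases` — **Kirby 2010, Thm 3.3 /
  Haykazyan 2016, Thm 16**: for `⟨H, cl⟩, ⟨H', cl'⟩ ∈ 𝒞` with bases `B, B'` and a bijection
  `B ≃ B'` there is an isomorphism `H ≃[L] H'` extending it (countable `B`: Thm 2.1; uncountable
  `B`: the union of the `f_X`);
* `IsQuasiminimalPregeometryClass.nonempty_equiv_of_mk_eq'` — **categoricity in every
  uncountable cardinality** (Kirby 2010, Cor. 3.4; Haykazyan 2016, §1), discharging the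
  hypothesis `h16` of `nonempty_equiv_of_mk_eq` (`PregeometryClasses.lean`).

Everything is proved; no named facts are introduced.

## References

* J. Kirby, *On quasiminimal excellent classes*, J. Symbolic Logic 75 (2010) 551–564,
  arXiv:0707.4496: Thm 2.1, Lemma 3.1, Lemma 3.2, Thm 3.3, Cor. 3.4.
* L. Haykazyan, *Categoricity in quasiminimal pregeometry classes*, J. Symbolic Logic 81 (2016)
  56–64, arXiv:1308.1892: Def. 2, Thm 16.
* M. Bays, B. Hart, T. Hyttinen, M. Kesälä, J. Kirby, *Quasiminimal structures and excellence*,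
  Bull. London Math. Soc. 46 (2014) 155–163: Thm 2.3, Prop. 6.2.
-/

noncomputable section

open Set
open FirstOrder FirstOrder.Language
open scoped Cardinal

universe u v w

namespace Literature.ModelTheory.Quasiminimal

namespace IsQuasiminimalPregeometryClass

variable {L : Language.{v, w}}
variable {𝒞 : ∀ (H : Type u) [L.Structure H], (Set H → Set H) → Prop}
variable {H H' : Type u} [L.Structure H] [L.Structure H'] {cl : Set H → Set H} {cl' : Set H' → Set H'}

/-! ### Swapping two generic points over a closed countable set -/

/-- **The swap automorphism** (Kirby 2010, proof of Thm 3.3: "By theorem 2.1, there is an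
automorphism `σ` of `H₀`, fixing `cl_H(G₀ Y_k)` and swapping `x_k` and `z`"). For a countable
closed `D` in a member of the class and `a, z` with `a ∉ cl (D ∪ {z})`, `z ∉ cl (D ∪ {a})`, there
is a partial embedding `σ` of `H` into itself on `H₀ = cl (D ∪ {a, z})`, mapping `H₀` onto
itself, equal to the identity on `D`, with `σ a = z` and `σ z = a`. (Two successor steps of
Thm 2.1 with uniqueness of the generic type.) [cite: Kirby2010QMEC, Thm 2.1, Thm 3.3 (proof)] -/
theorem exists_swap (h𝒞 : IsQuasiminimalPregeometryClass L 𝒞) (hH : 𝒞 H cl) {D : Set H}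
    (hDc : D.Countable) (hD : cl D = D) {a z : H} (ha : a ∉ cl (D ∪ {z}))
    (hz : z ∉ cl (D ∪ {a})) :
    ∃ σ : H → H, IsPartialEmbOn L σ (cl (D ∪ {a, z})) ∧
      σ '' cl (D ∪ {a, z}) = cl (D ∪ {a, z}) ∧ EqOn σ id D ∧ σ a = z ∧ σ z = a := by
  have hP := h𝒞.isPregeometry hH
  have hccp := h𝒞.countable_cl hH
  have haD : a ∉ cl D := fun h => ha (hP.mono subset_union_left h)
  have hzD : z ∉ cl D := fun h => hz (hP.mono subset_union_left h)
  -- first step: `id_D ∪ {a ↦ z}`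
  have hG : (cl D = D ∧ cl (id '' D) = id '' D) ∨ D = ∅ := Or.inl ⟨hD, by rwa [image_id]⟩
  have h1 : L.EqQFTypeOver₂ D id ![a] ![z] :=
    h𝒞.eqQFTypeOver₂_of_notMem_cl hH hH D id hDc hG (IsPartialEmbOn.id D) haD
      (by rwa [image_id])
  obtain ⟨F₁, hF₁, hF₁D, hF₁a, hF₁im⟩ := h𝒞.exists_isPartialEmbOn_cl_extend hH hH hDc hG h1
  rw [Matrix.range_cons, Matrix.range_empty, union_empty] at hF₁
  rw [Matrix.range_cons, Matrix.range_empty, union_empty, image_id, Matrix.range_cons,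
    Matrix.range_empty, union_empty] at hF₁im
  have hF₁a' : F₁ a = z := by simpa using hF₁a 0
  -- second step: `z ↦ a` over `D₁ = cl (D ∪ {a})`
  set D₁ := cl (D ∪ {a}) with hD₁
  have hD₁c : D₁.Countable := hP.countable_cl hccp (hDc.union (countable_singleton a))
  have hD₁cl : cl D₁ = D₁ := hP.cl_cl _
  have hF₁imcl : cl (F₁ '' D₁) = F₁ '' D₁ := by rw [hF₁im]; exact hP.cl_cl _
  have hG₁ : (cl D₁ = D₁ ∧ cl (F₁ '' D₁) = F₁ '' D₁) ∨ D₁ = ∅ := Or.inl ⟨hD₁cl, hF₁imcl⟩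
  have hz₁ : z ∉ cl D₁ := by rwa [hD₁cl]
  have ha₁ : a ∉ cl (F₁ '' D₁) := by rwa [hF₁imcl, hF₁im]
  have h2 : L.EqQFTypeOver₂ D₁ F₁ ![z] ![a] :=
    h𝒞.eqQFTypeOver₂_of_notMem_cl hH hH D₁ F₁ hD₁c hG₁ hF₁ hz₁ ha₁
  obtain ⟨σ, hσ, hσF₁, hσz, hσim⟩ := h𝒞.exists_isPartialEmbOn_cl_extend hH hH hD₁c hG₁ h2
  rw [Matrix.range_cons, Matrix.range_empty, union_empty] at hσ hσim
  rw [Matrix.range_cons, Matrix.range_empty, union_empty, hF₁im] at hσim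
  have hdom : cl (D₁ ∪ {z}) = cl (D ∪ {a, z}) := by
    rw [hD₁, hP.cl_cl_union, union_assoc]
    rfl
  have him : cl (cl (D ∪ {z}) ∪ {a}) = cl (D ∪ {a, z}) := by
    rw [hP.cl_cl_union, union_assoc]
    congr 1
    ext x; simp
  rw [hdom] at hσ hσim
  rw [him] at hσim
  refine ⟨σ, hσ, hσim, fun x hx => ?_, ?_, by simpa using hσz 0⟩
  · have hx₁ : x ∈ D₁ := hP.subset_cl _ (Or.inl hx)
    rw [hσF₁ hx₁, hF₁D hx]
  · have ha₁' : a ∈ D₁ := hP.subset_cl _ (Or.inr rfl)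
    rw [hσF₁ ha₁', hF₁a']

/-! ### The data of Kirby's proof -/

variable (L) in
/-- **The data of the proof of Kirby 2010, Thm 3.3** for two `L`-structures `H, H'` with closure
operators `cl, cl'`: independent sets `B ⊆ H`, `B' ⊆ H'`; a map `e : H → H'` injective on `B`
with `e[B] ⊆ B'` (the bijection of bases to be extended); an injective sequence `u` in `B` (its
range `B₀` is Kirby's countable part, `G = cl B₀`); and a partial embedding `f₀` on `cl B₀` with
image `cl (e[B₀])` extending `e` on `B₀` (Kirby's `f_∅`, from Thm 2.1).
[cite: Kirby2010QMEC, Thm 3.3 (proof)] -/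
structure KirbyData (H H' : Type u) [L.Structure H] [L.Structure H'] (cl : Set H → Set H)
    (cl' : Set H' → Set H') where
  /-- the independent set on the left (a basis of `H` in the application) -/
  B : Set H
  /-- the independent set on the right -/
  B' : Set H'
  /-- the map to be extended (a bijection `B → B'` in the application; arbitrary off `B`) -/
  e : H → H'
  /-- an injective sequence in `B`; `B₀ = range u` -/
  u : ℕ → H
  /-- the closed embedding of `cl B₀` extending `e|B₀` -/
  f₀ : H → H'
  hB : ClIndep cl B
  hB' : ClIndep cl' B'
  heB : ∀ b ∈ B, e b ∈ B'
  heinj : InjOn e B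
  hu : Function.Injective u
  huB : ∀ j, u j ∈ B
  hf₀ : IsPartialEmbOn L f₀ (cl (range u))
  hf₀img : f₀ '' cl (range u) = cl' (e '' range u)
  hf₀e : ∀ j, f₀ (u j) = e (u j)

namespace KirbyData

variable (K : KirbyData L H H' cl cl')

/-- The countable part `B₀ = range u` of the basis. [folklore] -/
def B₀ : Set H := range K.u

/-- The **face** of a finite `X ⊆ B ∖ B₀` at `x`: `F_x = cl (B₀ ∪ X ∖ {x})` (Kirby's
`cl_H(G Y_i)`, `Y_i = X ∖ {x_i}`). [cite: Kirby2010QMEC, Thm 3.3 (proof)] -/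
def F (X : Set H) (x : H) : Set H := cl (K.B₀ ∪ (X \ {x}))

/-- The corresponding face on the right: `cl' (e[B₀] ∪ e[X ∖ {x}])`. [folklore] -/
def F' (X : Set H) (x : H) : Set H' := cl' (K.e '' (K.B₀ ∪ (X \ {x})))

/-- **The compatible family, at `X`** (Kirby: "a closed embedding `f_X : cl_H(GX) → H'` such that
`f_X|X = ψ|X`", extending `f_∅ = f₀`): `f` is a partial embedding on `cl (B₀ ∪ X)` with image
`cl' (e[B₀ ∪ X])`, agreeing with `f₀` on `cl B₀` and with `e` on `X`.
[cite: Kirby2010QMEC, Thm 3.3 (proof)] -/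
structure GoodAt (X : Set H) (f : H → H') : Prop where
  /-- closed embedding of `cl (B₀ ∪ X)` … -/
  emb : IsPartialEmbOn L f (cl (K.B₀ ∪ X))
  /-- … onto `cl' (e[B₀ ∪ X])` -/
  img : f '' cl (K.B₀ ∪ X) = cl' (K.e '' (K.B₀ ∪ X))
  /-- extending `f₀` -/
  onB₀ : EqOn f K.f₀ (cl K.B₀)
  /-- and `e|X` -/
  onX : ∀ x ∈ X, f x = K.e x

variable {K}

section Basic

variable (h𝒞 : IsQuasiminimalPregeometryClass L 𝒞) (hH : 𝒞 H cl) (hH' : 𝒞 H' cl')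
include h𝒞 hH

/-- `B₀ ⊆ B`. [folklore] -/
theorem B₀_subset : K.B₀ ⊆ K.B := by
  have _ := h𝒞.isPregeometry hH
  rintro _ ⟨j, rfl⟩; exact K.huB j

/-- `B₀` is countable. [folklore] -/
theorem countable_B₀ : K.B₀.Countable := by
  have _ := h𝒞.isPregeometry hH
  exact countable_range _

/-- `B₀` is infinite. [folklore] -/
theorem infinite_B₀ : K.B₀.Infinite := by
  have _ := h𝒞.isPregeometry hH
  exact infinite_range_of_injective K.hu

/-- `cl B₀` is closed. [folklore] -/
theorem cl_B₀_closed : cl (cl K.B₀) = cl K.B₀ := (h𝒞.isPregeometry hH).cl_cl _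

/-- `cl (B₀ ∪ X)` is countable for finite `X`. [folklore] -/
theorem countable_cl_B₀_union {X : Set H} (hX : X.Finite) : (cl (K.B₀ ∪ X)).Countable :=
  (h𝒞.isPregeometry hH).countable_cl (h𝒞.countable_cl hH)
    ((K.countable_B₀ h𝒞 hH).union hX.countable)

omit hH in
include hH' in
/-- Closures on the right are closed. [folklore] -/
theorem cl'_image_closed (S : Set H) : cl' (cl' (K.e '' S)) = cl' (K.e '' S) :=
  (h𝒞.isPregeometry hH').cl_cl _

/-- `GoodAt ∅ f₀`. [folklore] -/
theorem goodAt_empty : K.GoodAt ∅ K.f₀ := by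
  have _ := h𝒞.isPregeometry hH
  refine ⟨?_, ?_, fun _ _ => rfl, fun x hx => absurd hx (notMem_empty x)⟩
  · simpa [B₀] using K.hf₀
  · simpa [B₀] using K.hf₀img

/-- An element of `B ∖ B₀` outside `S ⊆ B` is not in `cl (B₀ ∪ S)` when… (independence of `B`):
precisely, for `x ∈ B`, `x ∉ B₀`, `S ⊆ B`, `x ∉ S` we have `x ∉ cl (B₀ ∪ S)`. [folklore] -/
theorem notMem_cl_B₀_union {x : H} (hx : x ∈ K.B) (hxB₀ : x ∉ K.B₀) {S : Set H} (hS : S ⊆ K.B)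
    (hxS : x ∉ S) : x ∉ cl (K.B₀ ∪ S) :=
  K.hB.notMem_cl_of_subset (h𝒞.isPregeometry hH) hx (union_subset (K.B₀_subset h𝒞 hH) hS)
    (fun h => h.elim hxB₀ hxS)

omit hH in
include hH' in
/-- The same on the right-hand side, for images under `e`. [folklore] -/
theorem notMem_cl'_image {x : H} (hx : x ∈ K.B) {S : Set H} (hS : S ⊆ K.B) (hxS : x ∉ S) :
    K.e x ∉ cl' (K.e '' S) := by
  refine K.hB'.notMem_cl_of_subset (h𝒞.isPregeometry hH') (K.heB x hx) ?_ ?_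
  · rintro _ ⟨y, hy, rfl⟩; exact K.heB y (hS hy)
  · rintro ⟨y, hy, hyx⟩
    exact hxS (K.heinj (hS hy) hx hyx ▸ hy)

/-- **Kirby's Lemma 3.1 for the faces**: `cl (B₀ ∪ Y) ∩ cl (B₀ ∪ Z) = cl (B₀ ∪ (Y ∩ Z))` for
`Y, Z ⊆ B ∖ B₀`. [cite: Kirby2010QMEC, Lemma 3.1] -/
theorem cl_B₀_union_inter {Y Z : Set H} (hY : Y ⊆ K.B) (hZ : Z ⊆ K.B) :
    cl (K.B₀ ∪ Y) ∩ cl (K.B₀ ∪ Z) = cl (K.B₀ ∪ (Y ∩ Z)) := by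
  have hP := h𝒞.isPregeometry hH
  have hB₀ := K.B₀_subset h𝒞 hH
  rw [hP.cl_inter_cl_eq_of_clIndep K.hB (union_subset hB₀ hY) (union_subset hB₀ hZ)]
  congr 1
  ext x
  simp only [mem_inter_iff, mem_union]
  constructor
  · rintro ⟨hx | hx, hx' | hx'⟩
    · exact Or.inl hx
    · exact Or.inl hx
    · exact Or.inl hx'
    · exact Or.inr ⟨hx, hx'⟩
  · rintro (hx | ⟨hx, hx'⟩)
    · exact ⟨Or.inl hx, Or.inl hx⟩
    · exact ⟨Or.inr hx, Or.inr hx'⟩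

end Basic

/-! ### The isomorphism `ε_X : cl (B₀ ∪ X) ≅ cl' (e[B₀] ∪ e[X])` (Thm 2.1) -/

/-- **`ε_X`** (Kirby: the closed embedding `e : cl_H(GX) → H'` extending `f₀ ∪ ψ|X`, here taken
directly from Thm 2.1): for finite `X ⊆ B ∖ B₀` there is a partial embedding of `cl (B₀ ∪ X)` onto
`cl' (e[B₀ ∪ X])` extending `f₀` and `e|X` — i.e. `GoodAt X`. [cite: Kirby2010QMEC, Thm 2.1] -/
theorem exists_goodAt (h𝒞 : IsQuasiminimalPregeometryClass L 𝒞) (hH : 𝒞 H cl) (hH' : 𝒞 H' cl')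
    {X : Set H} (hXfin : X.Finite) (hXB : X ⊆ K.B) (hXB₀ : Disjoint X K.B₀) :
    ∃ f, K.GoodAt X f := by
  classical
  have hP := h𝒞.isPregeometry hH
  have hP' := h𝒞.isPregeometry hH'
  haveI : Countable X := hXfin.countable.to_subtype
  -- the independent families `X` and `e[X]` over `cl B₀`, `cl' e[B₀]`
  have hind : IndepFamilyOver cl (cl K.B₀) (fun x : X => (x : H)) :=
    K.hB.indepFamilyOver_cl hP (K.B₀_subset h𝒞 hH) Subtype.val_injective (fun x => hXB x.2)
      (fun x hx => hXB₀.le_bot ⟨x.2, hx⟩)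
  have hind' : IndepFamilyOver cl' (K.f₀ '' cl K.B₀) (fun x : X => K.e x) := by
    rw [show K.f₀ '' cl K.B₀ = cl' (K.e '' K.B₀) from K.hf₀img]
    intro x hx
    rw [hP'.cl_cl_union] at hx
    refine K.notMem_cl'_image h𝒞 hH' (hXB x.2) (S := K.B₀ ∪ ((fun y : X => (y : H)) '' {j | j ≠ x}))
      (union_subset (K.B₀_subset h𝒞 hH) ?_) ?_ ?_
    · rintro _ ⟨y, -, rfl⟩; exact hXB y.2
    · rintro (h | ⟨y, hy, hyx⟩)
      · exact hXB₀.le_bot ⟨x.2, h⟩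
      · exact hy (Subtype.val_injective hyx)
    · rw [image_union, image_image]
      exact hx
  obtain ⟨F, hF, hFf₀, hFx, hFim⟩ := h𝒞.exists_isPartialEmbOn_extend_indepFamily hH hH'
    (hP.countable_cl (h𝒞.countable_cl hH) (K.countable_B₀ h𝒞 hH))
    (Or.inl ⟨K.cl_B₀_closed h𝒞 hH, by
      rw [show K.f₀ '' cl K.B₀ = cl' (K.e '' K.B₀) from K.hf₀img]; exact hP'.cl_cl _⟩)
    K.hf₀ hind hind'
  have hr : range (fun x : X => (x : H)) = X := Subtype.range_coe
  have hr' : range (fun x : X => K.e x) = K.e '' X := by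
    ext y; constructor
    · rintro ⟨x, rfl⟩; exact ⟨x, x.2, rfl⟩
    · rintro ⟨x, hx, rfl⟩; exact ⟨⟨x, hx⟩, rfl⟩
  rw [hr, hP.cl_cl_union] at hF hFim
  rw [hr', show K.f₀ '' cl K.B₀ = cl' (K.e '' K.B₀) from K.hf₀img, hP'.cl_cl_union,
    ← image_union] at hFim
  exact ⟨F, hF, hFim, hFf₀, fun x hx => hFx ⟨x, hx⟩⟩

/-! ### Kirby's key step: the partial embedding of a face fixing the previous ones -/

/-- **Kirby 2010, proof of Thm 3.3, the induction on `k` (p. 7), normalised.** Let `X ⊆ B ∖ B₀`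
be finite, `k ∈ X`, `P ⊆ X ∖ {k}` (the indices of the previous faces), and `φ` a partial
embedding of `H` into itself on the face `F_k = cl (B₀ ∪ X ∖ {k})` which is the identity on
`cl B₀`, on `X ∖ {k}` and on `F_i ∩ F_k` for `i ∈ P`. Then for all finite tuples `ā` from
`⋃_{i ∈ P} F_i` and `c̄` from `F_k`: `qftp(ā, c̄) = qftp(ā, φ c̄)`.

Proof (Kirby): choose a finite `A ⊆ B₀` with `ā, c̄ ∈ cl(A X)` and `z ∈ B₀ ∖ A`; let `σ` be the
swap of `k` and `z` over `cl (A ∪ X ∖ {k})` (`exists_swap`). Then `σ c̄ = c̄`, `σ ā` lies in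
`⋃_{i ∈ P} F_i ∩ F_k` where `φ` is the identity, and `φ c̄ ∈ cl (A ∪ X ∖ {k})` is fixed by `σ`,
so `qftp(ā, c̄) = qftp(σā, c̄) = qftp(φσā, φc̄) = qftp(σā, φc̄) = qftp(ā, φc̄)`.
[cite: Kirby2010QMEC, Thm 3.3 (proof)] -/
theorem eqQFType₂_append_of_fixed (h𝒞 : IsQuasiminimalPregeometryClass L 𝒞) (hH : 𝒞 H cl)
    {X : Set H} (hXfin : X.Finite) (hXB : X ⊆ K.B) (hXB₀ : Disjoint X K.B₀) {k : H} (hk : k ∈ X)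
    {P : Finset H} {φ : H → H} (hφ : IsPartialEmbOn L φ (K.F X k))
    (hφB₀ : EqOn φ id (cl K.B₀)) (hφX : ∀ x ∈ X, x ≠ k → φ x = x)
    (hφP : ∀ i ∈ P, EqOn φ id (K.F X i ∩ K.F X k)) {p q : ℕ} {a : Fin p → H} {c : Fin q → H}
    (ha : ∀ j, a j ∈ ⋃ i ∈ P, K.F X i) (hc : ∀ j, c j ∈ K.F X k) :
    L.EqQFType₂ (Fin.append a c) (Fin.append a (φ ∘ c)) := by
  classical
  have hP := h𝒞.isPregeometry hH
  have hccp := h𝒞.countable_cl hH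
  have hB₀B := K.B₀_subset h𝒞 hH
  set Yk : Set H := X \ {k} with hYk
  have hYkX : Yk ⊆ X := sdiff_subset
  have hYkB : Yk ⊆ K.B := hYkX.trans hXB
  have hkYk : k ∉ Yk := fun h => h.2 rfl
  have hkB : k ∈ K.B := hXB hk
  have hkB₀ : k ∉ K.B₀ := fun h => hXB₀.le_bot ⟨hk, h⟩
  -- finite supports inside `B₀`
  have hsuppa : ∀ j, ∃ i ∈ P, ∃ A : Set H, A.Finite ∧ A ⊆ K.B₀ ∧
      a j ∈ cl (A ∪ (Yk \ {i}) ∪ {k}) := by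
    intro j
    obtain ⟨i, hi, hj⟩ : ∃ i ∈ P, a j ∈ K.F X i := by simpa only [mem_iUnion, exists_prop] using ha j
    obtain ⟨A₀, hA₀, hA₀fin, hjA₀⟩ := hP.finite_character hj
    refine ⟨i, hi, A₀ ∩ K.B₀, hA₀fin.inter_of_left _, inter_subset_right, hP.mono ?_ hjA₀⟩
    intro y hy
    rcases hA₀ hy with hyB₀ | hyY
    · exact Or.inl (Or.inl ⟨hy, hyB₀⟩)
    · by_cases hyk : y = k
      · exact Or.inr hyk
      · exact Or.inl (Or.inr ⟨⟨hyY.1, hyk⟩, hyY.2⟩)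
  have hsuppc : ∀ j, ∃ A : Set H, A.Finite ∧ A ⊆ K.B₀ ∧ c j ∈ cl (A ∪ Yk) := by
    intro j
    obtain ⟨A₀, hA₀, hA₀fin, hjA₀⟩ := hP.finite_character (hc j)
    refine ⟨A₀ ∩ K.B₀, hA₀fin.inter_of_left _, inter_subset_right, hP.mono ?_ hjA₀⟩
    intro y hy
    rcases hA₀ hy with hyB₀ | hyY
    · exact Or.inl ⟨hy, hyB₀⟩
    · exact Or.inr hyY
  choose ι hιP Aa hAafin hAaB₀ haA using hsuppa
  choose Ac hAcfin hAcB₀ hcA using hsuppc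
  set A : Set H := (⋃ j, Aa j) ∪ ⋃ j, Ac j with hAdef
  have hAfin : A.Finite := (finite_iUnion hAafin).union (finite_iUnion hAcfin)
  have hAB₀ : A ⊆ K.B₀ := union_subset (iUnion_subset hAaB₀) (iUnion_subset hAcB₀)
  have hAB : A ⊆ K.B := hAB₀.trans hB₀B
  -- a fresh element of `B₀`
  obtain ⟨z, hzB₀, hzA⟩ : ∃ z ∈ K.B₀, z ∉ A := (K.infinite_B₀ h𝒞 hH).exists_notMem_finite hAfin
  have hzB : z ∈ K.B := hB₀B hzB₀
  have hzX : z ∉ X := fun h => hXB₀.le_bot ⟨h, hzB₀⟩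
  have hzYk : z ∉ Yk := fun h => hzX (hYkX h)
  have hzk : z ≠ k := fun h => hkB₀ (h ▸ hzB₀)
  -- the closed countable base `D = cl (A ∪ Y_k)` and the swap
  set D : Set H := cl (A ∪ Yk) with hDdef
  have hDc : D.Countable := hP.countable_cl hccp (hAfin.countable.union (hXfin.countable.mono hYkX))
  have hDcl : cl D = D := hP.cl_cl _
  have hAYB : A ∪ Yk ⊆ K.B := union_subset hAB hYkB
  have hk_gen : k ∉ cl (D ∪ {z}) := by
    rw [hDdef, hP.cl_cl_union]
    refine K.hB.notMem_cl_of_subset hP hkB (union_subset hAYB (singleton_subset_iff.2 hzB)) ?_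
    rintro ((h | h) | h)
    · exact hkB₀ (hAB₀ h)
    · exact hkYk h
    · exact hzk.symm h
  have hz_gen : z ∉ cl (D ∪ {k}) := by
    rw [hDdef, hP.cl_cl_union]
    refine K.hB.notMem_cl_of_subset hP hzB (union_subset hAYB (singleton_subset_iff.2 hkB)) ?_
    rintro ((h | h) | h)
    · exact hzA h
    · exact hzYk h
    · exact hzk h
  obtain ⟨σ, hσ, hσim, hσD, hσk, hσz⟩ := h𝒞.exists_swap hH hDc hDcl hk_gen hz_gen
  set H₀ : Set H := cl (D ∪ {k, z}) with hH₀def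
  have hH₀cl : cl H₀ = H₀ := hP.cl_cl _
  have hDH₀ : D ⊆ H₀ := subset_union_left.trans (hP.subset_cl _)
  have hH₀eq : H₀ = cl (A ∪ Yk ∪ {k, z}) := by rw [hH₀def, hDdef, hP.cl_cl_union]
  -- where the tuples live
  have hAaA : ∀ j, Aa j ⊆ A := fun j => (subset_iUnion Aa j).trans subset_union_left
  have hAcA : ∀ j, Ac j ⊆ A := fun j => (subset_iUnion Ac j).trans subset_union_right
  have hcD : ∀ j, c j ∈ D := fun j => hP.mono (union_subset_union_left _ (hAcA j)) (hcA j)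
  have hcH₀ : ∀ j, c j ∈ H₀ := fun j => hDH₀ (hcD j)
  have hSj : ∀ j, Aa j ∪ (Yk \ {ι j}) ∪ {k} ⊆ A ∪ Yk ∪ {k, z} := by
    intro j y hy
    rcases hy with (hy | hy) | hy
    · exact Or.inl (Or.inl (hAaA j hy))
    · exact Or.inl (Or.inr hy.1)
    · exact Or.inr (Or.inl hy)
  have haH₀ : ∀ j, a j ∈ H₀ := fun j => by
    rw [hH₀eq]; exact hP.mono (hSj j) (haA j)
  have hADsub : A ∪ Yk ⊆ D := hP.subset_cl _
  have hσc : ∀ j, σ (c j) = c j := fun j => hσD (hcD j)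
  -- `σ ā` lies in the previous faces, inside `F_k`
  have hσa : ∀ j, σ (a j) ∈ K.F X (ι j) ∩ K.F X k := by
    intro j
    have hSH₀ : Aa j ∪ (Yk \ {ι j}) ∪ {k} ⊆ H₀ := by
      rw [hH₀eq]; exact (hSj j).trans (hP.subset_cl _)
    have h1 := (h𝒞.mem_cl_iff_mem_cl_image hH hH hσ hSH₀ (haH₀ j)).1 (haA j)
    have hT : σ '' (Aa j ∪ (Yk \ {ι j}) ∪ {k}) ⊆ K.B₀ ∪ (Yk \ {ι j}) := by
      rintro _ ⟨y, hy, rfl⟩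
      rcases hy with (hy | hy) | hy
      · rw [show σ y = y from hσD (hADsub (Or.inl (hAaA j hy)))]
        exact Or.inl (hAaB₀ j hy)
      · rw [show σ y = y from hσD (hADsub (Or.inr hy.1))]
        exact Or.inr hy
      · rw [mem_singleton_iff.1 hy, hσk]
        exact Or.inl hzB₀
    constructor
    · refine hP.mono (hT.trans (union_subset_union_right _ ?_)) h1
      intro y hy
      exact ⟨hy.1.1, hy.2⟩
    · exact hP.mono (hT.trans (union_subset_union_right _ sdiff_subset)) h1
  have hφσa : ∀ j, φ (σ (a j)) = σ (a j) := fun j => hφP (ι j) (hιP j) (hσa j)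
  have hσaH₀ : ∀ j, σ (a j) ∈ H₀ := fun j => hσim ▸ mem_image_of_mem σ (haH₀ j)
  -- `φ c̄ ∈ D`, fixed by `σ`
  have hDFk : D ⊆ K.F X k := hP.mono (union_subset_union_left _ hAB₀)
  have hφc : ∀ j, φ (c j) ∈ D := by
    intro j
    have hS : A ∪ Yk ⊆ K.F X k := hADsub.trans hDFk
    have h1 := (h𝒞.mem_cl_iff_mem_cl_image hH hH hφ hS (hDFk (hcD j))).1 (hcA j |> fun h =>
      hP.mono (union_subset_union_left _ (hAcA j)) h)
    have himg : φ '' (A ∪ Yk) = A ∪ Yk := by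
      refine (image_congr fun y hy => ?_).trans (image_id _)
      rcases hy with hy | hy
      · exact hφB₀ (hP.subset_cl _ (hAB₀ hy))
      · exact hφX y hy.1 hy.2
    rwa [himg] at h1
  have hσφc : ∀ j, σ (φ (c j)) = φ (c j) := fun j => hσD (hφc j)
  have hφcH₀ : ∀ j, φ (c j) ∈ H₀ := fun j => hDH₀ (hφc j)
  -- the inverse of `σ` on `H₀`
  haveI : Nonempty H := ⟨k⟩
  set σ' := Function.invFunOn σ H₀ with hσ'def
  have hσ'σ : ∀ y ∈ H₀, σ' (σ y) = y := fun y hy => hσ.injOn.leftInvOn_invFunOn hy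
  have hσ' : IsPartialEmbOn L σ' H₀ := by
    have := hσ.inverse hσ'σ
    rwa [hσim] at this
  -- the chain
  have e1 := hσ (Fin.append a c) (fun i => by
    refine Fin.addCases (fun j => ?_) (fun j => ?_) i
    · simpa using haH₀ j
    · simpa using hcH₀ j)
  rw [comp_append', show σ ∘ c = c from funext hσc] at e1
  have e2 := hφ (Fin.append (σ ∘ a) c) (fun i => by
    refine Fin.addCases (fun j => ?_) (fun j => ?_) i
    · simpa using (hσa j).2
    · simpa using hc j)
  rw [comp_append', show φ ∘ (σ ∘ a) = σ ∘ a from funext hφσa] at e2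
  have e3 := hσ' (Fin.append (σ ∘ a) (φ ∘ c)) (fun i => by
    refine Fin.addCases (fun j => ?_) (fun j => ?_) i
    · simpa using hσaH₀ j
    · simpa using hφcH₀ j)
  rw [comp_append', show σ' ∘ (σ ∘ a) = a from funext fun j => hσ'σ _ (haH₀ j),
    show σ' ∘ (φ ∘ c) = φ ∘ c from funext fun j => by
      simp only [Function.comp_apply]
      conv_lhs => rw [← hσφc j]
      exact hσ'σ _ (hφcH₀ j)] at e3
  exact e1.trans (e2.trans e3)

/-! ### Interleaving a finite tuple with the sequence `u` -/

section Interleave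

variable {n : ℕ}

/-- The sequence `x₀, …, x_{n-1}, u₀, u₁, …`. [folklore] -/
def interleave (xs : Fin n → H) (u : ℕ → H) (j : ℕ) : H :=
  if h : j < n then xs ⟨j, h⟩ else u (j - n)

omit [L.Structure H] in
/-- The first `n` values of the interleaved sequence. [folklore] -/
theorem interleave_lt (xs : Fin n → H) (u : ℕ → H) {j : ℕ} (h : j < n) :
    interleave xs u j = xs ⟨j, h⟩ := dif_pos h

omit [L.Structure H] in
/-- The later values of the interleaved sequence. [folklore] -/
theorem interleave_add (xs : Fin n → H) (u : ℕ → H) (j : ℕ) :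
    interleave xs u (n + j) = u j := by
  simp [interleave]

omit [L.Structure H] in
/-- The range of the interleaved sequence. [folklore] -/
theorem range_interleave (xs : Fin n → H) (u : ℕ → H) :
    range (interleave xs u) = range xs ∪ range u := by
  ext y
  constructor
  · rintro ⟨j, rfl⟩
    by_cases h : j < n
    · exact Or.inl ⟨⟨j, h⟩, (interleave_lt xs u h).symm⟩
    · refine Or.inr ⟨j - n, ?_⟩
      simp [interleave, h]
  · rintro (⟨i, rfl⟩ | ⟨j, rfl⟩)
    · exact ⟨i, by rw [interleave_lt xs u i.isLt]⟩
    · exact ⟨n + j, interleave_add xs u j⟩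

omit [L.Structure H] in
/-- The interleaved sequence of injective disjoint families is injective. [folklore] -/
theorem interleave_injective {xs : Fin n → H} {u : ℕ → H} (hxs : Function.Injective xs)
    (hu : Function.Injective u) (hdisj : ∀ i j, xs i ≠ u j) :
    Function.Injective (interleave xs u) := by
  intro j l hjl
  by_cases hj : j < n <;> by_cases hl : l < n
  · rw [interleave_lt xs u hj, interleave_lt xs u hl] at hjl
    exact Fin.mk.inj_iff.1 (hxs hjl)
  · rw [interleave_lt xs u hj] at hjl
    simp only [interleave, dif_neg hl] at hjl
    exact absurd hjl (hdisj _ _)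
  · rw [interleave_lt xs u hl] at hjl
    simp only [interleave, dif_neg hj] at hjl
    exact absurd hjl.symm (hdisj _ _)
  · simp only [interleave, dif_neg hj, dif_neg hl] at hjl
    have := hu hjl
    omega

omit [L.Structure H] in
/-- For an injective sequence, the other values are the range minus the value. [folklore] -/
theorem image_setOf_ne_of_injective {f : ℕ → H} (hf : Function.Injective f) (j : ℕ) :
    f '' {l | l ≠ j} = range f \ {f j} := by
  ext y
  constructor
  · rintro ⟨l, hl, rfl⟩
    exact ⟨⟨l, rfl⟩, fun h => hl (hf h)⟩
  · rintro ⟨⟨l, rfl⟩, hl⟩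
    exact ⟨l, fun h => hl (by rw [h]; rfl), rfl⟩

end Interleave

/-! ### Pulling back along `ε_X` -/

/-- **The inverse of a good map.** From `GoodAt X ε`: an inverse `ι` of `ε` on
`M'_X = cl' (e[B₀ ∪ X])`, a partial embedding of `H'` into `H` there with image `M_X = cl (B₀ ∪ X)`,
carrying `e y ↦ y` for `y ∈ B₀ ∪ X`. [folklore] -/
theorem GoodAt.exists_inverse (h𝒞 : IsQuasiminimalPregeometryClass L 𝒞) (hH : 𝒞 H cl)
    {X : Set H} {ε : H → H'} (hε : K.GoodAt X ε) :
    ∃ ι : H' → H, (∀ y ∈ cl (K.B₀ ∪ X), ι (ε y) = y) ∧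
      (∀ y' ∈ cl' (K.e '' (K.B₀ ∪ X)), ε (ι y') = y') ∧
      IsPartialEmbOn L ι (cl' (K.e '' (K.B₀ ∪ X))) ∧
      ι '' cl' (K.e '' (K.B₀ ∪ X)) = cl (K.B₀ ∪ X) ∧
      (∀ y ∈ K.B₀ ∪ X, ε y = K.e y) ∧ ∀ y ∈ K.B₀ ∪ X, ι (K.e y) = y := by
  classical
  have hP := h𝒞.isPregeometry hH
  haveI : Nonempty H := ⟨K.u 0⟩
  set ι := Function.invFunOn ε (cl (K.B₀ ∪ X)) with hιdef
  have hιε : ∀ y ∈ cl (K.B₀ ∪ X), ι (ε y) = y := fun y hy => hε.emb.injOn.leftInvOn_invFunOn hy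
  have hει : ∀ y' ∈ cl' (K.e '' (K.B₀ ∪ X)), ε (ι y') = y' := by
    intro y' hy'
    rw [← hε.img] at hy'
    obtain ⟨y, hy, rfl⟩ := hy'
    rw [hιε y hy]
  have hι : IsPartialEmbOn L ι (cl' (K.e '' (K.B₀ ∪ X))) := by
    have := hε.emb.inverse hιε
    rwa [hε.img] at this
  have hιimg : ι '' cl' (K.e '' (K.B₀ ∪ X)) = cl (K.B₀ ∪ X) := by
    rw [← hε.img, image_image]
    refine (image_congr fun y hy => hιε y hy).trans (image_id _) |>.trans ?_
    rfl
  have hεe : ∀ y ∈ K.B₀ ∪ X, ε y = K.e y := by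
    rintro y (⟨j, rfl⟩ | hy)
    · rw [hε.onB₀ (hP.subset_cl _ ⟨j, rfl⟩), K.hf₀e]
    · exact hε.onX y hy
  refine ⟨ι, hιε, hει, hι, hιimg, hεe, fun y hy => ?_⟩
  rw [← hεe y hy, hιε y (hP.subset_cl _ hy)]

/-! ### The amalgamation step (Kirby 2010, Thm 3.3: `g_X` is a partial embedding, and `f_X`) -/

/-- Crowns lie inside the closure of the family. [folklore] -/
theorem crown_subset_cl_range {M : Type*} {c : Set M → Set M} (h : IsPregeometry c) (b : ℕ → M)
    (S : Finset ℕ) : crown c b S ⊆ c (range b) := by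
  intro z hz
  obtain ⟨i, -, hz⟩ := mem_crown_iff.1 hz
  exact h.mono (image_subset_range _ _) hz

/-- **The amalgamation step of Kirby 2010, Thm 3.3.** Let `X ⊆ B ∖ B₀` be finite with `|X| ≥ 2`,
and let `𝔣` assign to every proper subset `Y ⊊ X` a good map `f_Y` (`GoodAt`), compatibly
(`f_Z = f_Y` on `cl (B₀ ∪ Z)` for `Z ⊆ Y ⊊ X`). Then there is a good map `f_X` at `X` extending
all the `f_Y`. Proof (source, pp. 6–7): let `Yₓ = X ∖ {x}`; the union `g_X` of the `f_{Yₓ}` on the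
crown `⋃ₓ cl (B₀ ∪ Yₓ)` is well defined by Lemma 3.1 and compatibility; pulled back along
`ε_X : cl (B₀ ∪ X) ≅ cl (e[B₀ ∪ X])` (Thm 2.1) it becomes a partial self-map `γ` of `H` fixing
`cl B₀`, `X` and every face; by induction on `k`, `γ` is a partial embedding on the first `k`
faces (`eqQFType₂_append_of_fixed` with the automorphism `Γ` extending `γ` on the first `k - 1`
faces, from Lemma 3.2 = `exists_isPartialEmbOn_extend_crown`); finally `γ` on all faces extends
to `Γ_X` (Lemma 3.2 again) and `f_X = ε_X ∘ Γ_X`. [cite: Kirby2010QMEC, Thm 3.3 (proof)] -/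
theorem exists_goodAt_extend (h𝒞 : IsQuasiminimalPregeometryClass L 𝒞) (hH : 𝒞 H cl)
    (hH' : 𝒞 H' cl') {X : Finset H} (hXB : ↑X ⊆ K.B) (hXB₀ : Disjoint (↑X : Set H) K.B₀)
    (hX2 : 2 ≤ X.card) (𝔣 : Finset H → (H → H')) (hgood : ∀ Y, Y ⊂ X → K.GoodAt ↑Y (𝔣 Y))
    (hcoh : ∀ Y, Y ⊂ X → ∀ Z, Z ⊆ Y → EqOn (𝔣 Z) (𝔣 Y) (cl (K.B₀ ∪ ↑Z))) :
    ∃ f, K.GoodAt ↑X f ∧ ∀ Y, Y ⊂ X → EqOn (𝔣 Y) f (cl (K.B₀ ∪ ↑Y)) := by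
  classical
  have hP := h𝒞.isPregeometry hH
  have hP' := h𝒞.isPregeometry hH'
  haveI : Nonempty H := ⟨K.u 0⟩
  set XS : Set H := ↑X with hXSdef
  have hXfin : XS.Finite := X.finite_toSet
  set M : Set H := cl (K.B₀ ∪ XS) with hMdef
  set M' : Set H' := cl' (K.e '' (K.B₀ ∪ XS)) with hM'def
  -- `ε_X` and its inverse
  obtain ⟨ε, hε⟩ := K.exists_goodAt h𝒞 hH hH' hXfin hXB hXB₀
  obtain ⟨ι, hιε, hει, hι, hιimg, hεe, hιe⟩ := hε.exists_inverse h𝒞 hH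
  -- the faces and their maps `γₓ = ι ∘ f_{X ∖ x}`
  have herase : ∀ x ∈ X, X.erase x ⊂ X := fun x hx => Finset.erase_ssubset hx
  have hcoe_erase : ∀ x, (↑(X.erase x) : Set H) = XS \ {x} := fun x => Finset.coe_erase x X
  have hfx : ∀ x ∈ X, K.GoodAt (XS \ {x}) (𝔣 (X.erase x)) := fun x hx => by
    rw [← hcoe_erase]; exact hgood _ (herase x hx)
  have hFsubM : ∀ x, K.F XS x ⊆ M := fun x => hP.mono (union_subset_union_right _ sdiff_subset)
  have hF'subM' : ∀ x, K.F' XS x ⊆ M' := fun x =>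
    hP'.mono (image_mono (union_subset_union_right _ sdiff_subset))
  have hfx_img : ∀ x ∈ X, 𝔣 (X.erase x) '' K.F XS x = K.F' XS x := fun x hx => (hfx x hx).img
  set γx : H → H → H := fun x z => ι (𝔣 (X.erase x) z) with hγxdef
  have hγx_emb : ∀ x ∈ X, IsPartialEmbOn L (γx x) (K.F XS x) := fun x hx =>
    (hfx x hx).emb.comp (hι.mono (by rw [(hfx x hx).img]; exact hF'subM' x))
  have hιeT : ∀ T, T ⊆ K.B₀ ∪ XS → ι '' (K.e '' T) = T := by
    intro T hT
    rw [image_image]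
    exact (image_congr fun y hy => hιe y (hT hy)).trans (image_id _) |>.trans rfl
  have hγx_img : ∀ x ∈ X, γx x '' K.F XS x = K.F XS x := by
    intro x hx
    show (fun z => ι (𝔣 (X.erase x) z)) '' K.F XS x = K.F XS x
    rw [← image_image ι, hfx_img x hx]
    show ι '' cl' (K.e '' (K.B₀ ∪ (XS \ {x}))) = cl (K.B₀ ∪ (XS \ {x}))
    rw [h𝒞.image_cl_eq_of_closed hH' hH hι (hP'.cl_cl _) (by rw [hιimg]; exact hP.cl_cl _)
      ((image_mono (union_subset_union_right _ sdiff_subset)).trans (hP'.subset_cl _)),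
      hιeT _ (union_subset_union_right _ sdiff_subset)]
  have hclB₀M : cl K.B₀ ⊆ M := hP.mono subset_union_left
  have hγx_B₀ : ∀ x ∈ X, EqOn (γx x) id (cl K.B₀) := by
    intro x hx z hz
    show ι (𝔣 (X.erase x) z) = z
    rw [(hfx x hx).onB₀ hz, ← hε.onB₀ hz, hιε z (hclB₀M hz)]
  have hγx_X : ∀ x ∈ X, ∀ y ∈ X, y ≠ x → γx x y = y := by
    intro x hx y hy hyx
    show ι (𝔣 (X.erase x) y) = y
    rw [(hfx x hx).onX y ⟨hy, hyx⟩, hιe y (Or.inr hy)]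
  -- the glued map `γ` (Kirby's `g_X`, pulled back)
  let γ : H → H := fun z => if h : ∃ x ∈ X, z ∈ K.F XS x then γx h.choose z else z
  have hγagree : ∀ x ∈ X, EqOn γ (γx x) (K.F XS x) := by
    intro x hx z hz
    have h : ∃ x ∈ X, z ∈ K.F XS x := ⟨x, hx, hz⟩
    simp only [γ, dif_pos h]
    have hx₀ : h.choose ∈ X := h.choose_spec.1
    have hz₀ : z ∈ K.F XS h.choose := h.choose_spec.2
    have hzint : z ∈ cl (K.B₀ ∪ ((XS \ {h.choose}) ∩ (XS \ {x}))) := by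
      rw [← K.cl_B₀_union_inter h𝒞 hH (sdiff_subset.trans hXB) (sdiff_subset.trans hXB)]
      exact ⟨hz₀, hz⟩
    have hZ : (↑(X.erase h.choose ∩ X.erase x) : Set H) = (XS \ {h.choose}) ∩ (XS \ {x}) := by
      rw [Finset.coe_inter, hcoe_erase, hcoe_erase]
    rw [← hZ] at hzint
    show ι (𝔣 (X.erase h.choose) z) = ι (𝔣 (X.erase x) z)
    rw [← hcoh (X.erase h.choose) (herase _ hx₀) (X.erase h.choose ∩ X.erase x)
      Finset.inter_subset_left hzint,
      hcoh (X.erase x) (herase x hx) (X.erase h.choose ∩ X.erase x) Finset.inter_subset_right hzint]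
  obtain ⟨x₁, hx₁⟩ : X.Nonempty := Finset.card_pos.1 (by omega)
  have hclB₀F : ∀ x, cl K.B₀ ⊆ K.F XS x := fun x => hP.mono subset_union_left
  have hγB₀ : EqOn γ id (cl K.B₀) := fun z hz => by
    rw [hγagree x₁ hx₁ (hclB₀F x₁ hz)]; exact hγx_B₀ x₁ hx₁ hz
  have hγX : ∀ y ∈ X, γ y = y := by
    intro y hy
    obtain ⟨x, hx, hxy⟩ := Finset.exists_mem_ne (by omega : 1 < X.card) y
    have hyF : y ∈ K.F XS x :=
      hP.subset_cl _ (Or.inr ⟨hy, fun h => hxy (mem_singleton_iff.1 h).symm⟩)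
    rw [hγagree x hx hyF]
    exact hγx_X x hx y hy (Ne.symm hxy)
  have hγimgF : ∀ x ∈ X, γ '' K.F XS x = K.F XS x := fun x hx =>
    (image_congr (hγagree x hx)).trans (hγx_img x hx)
  -- the enumeration `w` of `X` followed by `u`
  set n := X.card with hndef
  let xs : Fin n → H := fun i => (X.equivFin.symm i : H)
  have hxs_mem : ∀ i, xs i ∈ X := fun i => (X.equivFin.symm i).2
  have hxs_inj : Function.Injective xs := fun i j h =>
    X.equivFin.symm.injective (Subtype.ext h)
  have hxs_surj : ∀ y ∈ X, ∃ i, xs i = y := fun y hy => ⟨X.equivFin ⟨y, hy⟩, by simp [xs]⟩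
  set w : ℕ → H := interleave xs K.u with hwdef
  have hw_inj : Function.Injective w :=
    interleave_injective hxs_inj K.hu fun i j h => hXB₀.le_bot ⟨(hxs_mem i : xs i ∈ XS), ⟨j, h.symm⟩⟩
  have hrange_xs : range xs = XS := by
    ext y
    exact ⟨fun ⟨i, hi⟩ => hi ▸ hxs_mem i, fun hy => hxs_surj y hy⟩
  have hw_range : range w = K.B₀ ∪ XS := by
    rw [hwdef, range_interleave, hrange_xs, union_comm]; rfl
  have hwB : ∀ j, w j ∈ K.B := fun j => by
    have : w j ∈ range w := mem_range_self j
    rw [hw_range] at this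
    exact this.elim (fun h => K.B₀_subset h𝒞 hH h) (fun h => hXB h)
  have hw : IndepFamilyOver cl ∅ w := K.hB.indepFamilyOver_empty hP hw_inj hwB
  have hw_lt : ∀ {j : ℕ} (hj : j < n), w j = xs ⟨j, hj⟩ := fun hj => interleave_lt xs K.u hj
  have hwX : ∀ {j : ℕ}, j < n → w j ∈ X := fun hj => by rw [hw_lt hj]; exact hxs_mem _
  have hw_ge : ∀ {j : ℕ}, ¬ j < n → w j = K.u (j - n) := fun hj => by
    simp [hwdef, interleave, hj]
  have hface : ∀ {j : ℕ}, j < n → face cl w j = K.F XS (w j) := by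
    intro j hj
    rw [face, image_setOf_ne_of_injective hw_inj, hw_range]
    show cl ((K.B₀ ∪ XS) \ {w j}) = cl (K.B₀ ∪ (XS \ {w j}))
    have hwj : w j ∉ K.B₀ := fun h => hXB₀.le_bot ⟨(hwX hj : w j ∈ XS), h⟩
    congr 1
    ext y
    simp only [mem_sdiff, mem_union, mem_singleton_iff]
    constructor
    · rintro ⟨hy | hy, hne⟩
      · exact Or.inl hy
      · exact Or.inr ⟨hy, hne⟩
    · rintro (hy | ⟨hy, hne⟩)
      · exact ⟨Or.inl hy, fun h => hwj (h ▸ hy)⟩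
      · exact ⟨Or.inr hy, hne⟩
  have hclw : cl (range w) = M := by rw [hw_range]
  have hcrown : ∀ {k : ℕ}, k ≤ n →
      crown cl w (Finset.range k) = ⋃ x ∈ (Finset.range k).image w, K.F XS x := by
    intro k hk
    rw [Finset.set_biUnion_finset_image]
    show (⋃ j ∈ Finset.range k, face cl w j) = ⋃ j ∈ Finset.range k, K.F XS (w j)
    exact iUnion₂_congr fun j hj => hface (lt_of_lt_of_le (Finset.mem_range.1 hj) hk)
  have hcrownM : ∀ S : Finset ℕ, crown cl w S ⊆ M := fun S =>
    (crown_subset_cl_range hP w S).trans hclw.le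
  have hγw : ∀ j, γ (w j) = w j := fun j => by
    by_cases hj : j < n
    · exact hγX _ (hwX hj)
    · rw [hw_ge hj]; exact hγB₀ (hP.subset_cl _ ⟨j - n, rfl⟩)
  have hγfaces : ∀ {k : ℕ}, k ≤ n → ∀ j ∈ Finset.range k, γ '' face cl w j = face cl w j := by
    intro k hk j hj
    have hj' := lt_of_lt_of_le (Finset.mem_range.1 hj) hk
    rw [hface hj']
    exact hγimgF _ (hwX hj')
  -- **the induction on `k`**: `γ` is a partial embedding on the first `k` faces
  have hQ : ∀ k, 1 ≤ k → k ≤ n → IsPartialEmbOn L γ (crown cl w (Finset.range k)) := by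
    intro k
    induction k with
    | zero => intro h; omega
    | succ k ih =>
      intro _ hkn
      have hkn' : k < n := hkn
      rcases Nat.eq_zero_or_pos k with rfl | hkpos
      · -- one face
        have h0 : (0 : ℕ) < n := hkn'
        rw [zero_add, Finset.range_one, crown_singleton, hface h0]
        exact (hγx_emb _ (hwX h0)).congr fun z hz => (hγagree _ (hwX h0) hz).symm
      · have ih' := ih hkpos hkn'.le
        set xk := w k with hxkdef
        have hxkX : xk ∈ X := hwX hkn'
        have hSne : (Finset.range k).Nonempty := ⟨0, Finset.mem_range.2 hkpos⟩
        -- `Γ ⊇ γ|first k faces` (Lemma 3.2)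
        obtain ⟨Γ, hΓbij, hΓ, hΓimg, hΓγ, hΓw, -⟩ :=
          h𝒞.exists_isPartialEmbOn_extend_crown hH hw hSne ih' (hγfaces hkn'.le) hγw
        rw [hclw] at hΓ hΓimg
        set Γ' := Function.invFun Γ with hΓ'def
        have hΓ'Γ : ∀ z, Γ' (Γ z) = z := Function.leftInverse_invFun hΓbij.1
        have hΓΓ' : ∀ z, Γ (Γ' z) = z := Function.rightInverse_invFun hΓbij.2
        have hΓ' : IsPartialEmbOn L Γ' M := by
          have := hΓ.inverse (f' := Γ') fun z _ => hΓ'Γ z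
          rwa [hΓimg] at this
        have hΓ'M : ∀ z ∈ M, Γ' z ∈ M := fun z hz => by
          have : z ∈ Γ '' M := hΓimg.symm ▸ hz
          obtain ⟨y, hy, rfl⟩ := this
          rw [hΓ'Γ]; exact hy
        have hC := hcrown hkn'.le
        have hclB₀C : cl K.B₀ ⊆ crown cl w (Finset.range k) := by
          refine (hclB₀F (w 0)).trans ?_
          rw [← hface (lt_of_lt_of_le hkpos hkn'.le)]
          exact face_subset_crown (Finset.mem_range.2 hkpos)
        have hΓfixB₀ : ∀ z ∈ cl K.B₀, Γ z = z := fun z hz => by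
          rw [hΓγ z (hclB₀C hz)]; exact hγB₀ hz
        -- the normalised face map `φ = Γ⁻¹ ∘ γ_{x_k}`
        set φ : H → H := fun z => Γ' (γx xk z) with hφdef
        have hφ : IsPartialEmbOn L φ (K.F XS xk) :=
          (hγx_emb xk hxkX).comp (hΓ'.mono (by rw [hγx_img xk hxkX]; exact hFsubM xk))
        have hφB₀ : EqOn φ id (cl K.B₀) := fun z hz => by
          show Γ' (γx xk z) = z
          rw [hγx_B₀ xk hxkX hz]
          conv_lhs => rw [show (id z : H) = Γ z from (hΓfixB₀ z hz).symm]
          exact hΓ'Γ z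
        have hφX : ∀ y ∈ XS, y ≠ xk → φ y = y := fun y hy hyk => by
          show Γ' (γx xk y) = y
          rw [hγx_X xk hxkX y hy hyk]
          obtain ⟨i, rfl⟩ := hxs_surj y hy
          conv_lhs => rw [← hw_lt i.isLt, ← hΓw i]
          rw [hΓ'Γ, hw_lt i.isLt]
        have hφP : ∀ i ∈ (Finset.range k).image w, EqOn φ id (K.F XS i ∩ K.F XS xk) := by
          rintro i hi z ⟨hzi, hzk⟩
          have hzC : z ∈ crown cl w (Finset.range k) := by
            rw [hC]; exact mem_iUnion₂.2 ⟨i, hi, hzi⟩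
          show Γ' (γx xk z) = z
          rw [← hγagree xk hxkX hzk, ← hΓγ z hzC, hΓ'Γ]
        -- the new crown
        have hsucc : crown cl w (Finset.range (k + 1)) = crown cl w (Finset.range k) ∪ K.F XS xk := by
          rw [Finset.range_add_one]
          show (⋃ j ∈ insert k (Finset.range k), face cl w j) = _
          rw [Finset.set_biUnion_insert, hface hkn', union_comm]
          rfl
        rw [hsucc]
        refine isPartialEmbOn_union_of_append fun p q a c ha hc => ?_
        have ha' : ∀ j, a j ∈ ⋃ i ∈ (Finset.range k).image w, K.F XS i := fun j => by
          rw [← hC]; exact ha j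
        have e1 := K.eqQFType₂_append_of_fixed h𝒞 hH hXfin hXB hXB₀ (show xk ∈ XS from hxkX)
          (P := (Finset.range k).image w) hφ hφB₀ hφX hφP ha' hc
        have haM : ∀ j, a j ∈ M := fun j => hcrownM _ (ha j)
        have hφcM : ∀ j, φ (c j) ∈ M := fun j =>
          hΓ'M _ (hFsubM xk (by rw [← hγx_img xk hxkX]; exact mem_image_of_mem _ (hc j)))
        have e2 := hΓ (Fin.append a (φ ∘ c)) (fun i => by
          refine Fin.addCases (fun j => ?_) (fun j => ?_) i
          · simpa using haM j
          · simpa using hφcM j)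
        have eqa : Γ ∘ a = γ ∘ a := funext fun j => hΓγ _ (ha j)
        have eqc : Γ ∘ (φ ∘ c) = γ ∘ c := funext fun j => by
          show Γ (Γ' (γx xk (c j))) = γ (c j)
          rw [hΓΓ', hγagree xk hxkX (hc j)]
        rw [comp_append', eqa, eqc] at e2
        exact e1.trans e2
  -- **the extension to `cl (B₀ ∪ X)`** (Lemma 3.2) and `f_X = ε ∘ Γ_X`
  have hn1 : 1 ≤ n := by omega
  have hQn := hQ n hn1 le_rfl
  have hSne : (Finset.range n).Nonempty := ⟨0, Finset.mem_range.2 hn1⟩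
  obtain ⟨Γ, -, hΓ, hΓimg, hΓγ, hΓw, -⟩ :=
    h𝒞.exists_isPartialEmbOn_extend_crown hH hw hSne hQn (hγfaces le_rfl) hγw
  rw [hclw] at hΓ hΓimg
  have hclB₀C : cl K.B₀ ⊆ crown cl w (Finset.range n) := by
    refine (hclB₀F (w 0)).trans ?_
    rw [← hface hn1]
    exact face_subset_crown (Finset.mem_range.2 hn1)
  refine ⟨fun z => ε (Γ z), ⟨?_, ?_, ?_, ?_⟩, ?_⟩
  · exact hΓ.comp (hε.emb.mono hΓimg.le)
  · show (fun z => ε (Γ z)) '' M = M'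
    rw [← image_image ε Γ, hΓimg, hε.img]
  · intro z hz
    show ε (Γ z) = K.f₀ z
    rw [hΓγ z (hclB₀C hz), hγB₀ hz]
    exact hε.onB₀ hz
  · intro y hy
    show ε (Γ y) = K.e y
    obtain ⟨i, rfl⟩ := hxs_surj y hy
    rw [← hw_lt i.isLt, hΓw i, hw_lt i.isLt]
    exact hεe _ (Or.inr hy)
  · intro Y hY z hz
    obtain ⟨x, hxX, hxY⟩ := Finset.exists_of_ssubset hY
    have hYx : Y ⊆ X.erase x := fun y hy =>
      Finset.mem_erase.2 ⟨fun h => hxY (h ▸ hy), hY.1 hy⟩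
    have hzF : z ∈ K.F XS x := by
      refine hP.mono (union_subset_union_right _ ?_) hz
      rw [← hcoe_erase]; exact Finset.coe_subset.2 hYx
    rw [hcoh (X.erase x) (herase x hxX) Y hYx hz]
    obtain ⟨i, hi⟩ := hxs_surj x hxX
    have hzC : z ∈ crown cl w (Finset.range n) := by
      refine face_subset_crown (Finset.mem_range.2 i.isLt) ?_
      rw [hface i.isLt, hw_lt i.isLt, hi]
      exact hzF
    show 𝔣 (X.erase x) z = ε (Γ z)
    rw [hΓγ z hzC, hγagree x hxX hzF]
    show 𝔣 (X.erase x) z = ε (ι (𝔣 (X.erase x) z))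
    rw [hει _ (hF'subM' x (by rw [← hfx_img x hxX]; exact mem_image_of_mem _ hzF))]

/-! ### The recursion over finite subsets of `B ∖ B₀` -/

/-- **The compatible family `(f_X)`** (Kirby 2010, Thm 3.3: "We construct the `f_X` by
well-founded induction on the partial order of finite subsets of `B`"): good maps `f_X` for all
finite `X ⊆ B ∖ B₀`, with `f_Y = f_X` on `cl (B₀ ∪ Y)` whenever `Y ⊆ X` — by recursion on `|X|`,
using `f_∅ = f₀`, `ε_X` for `|X| = 1` and `exists_goodAt_extend` for `|X| ≥ 2`.
[cite: Kirby2010QMEC, Thm 3.3 (proof)] -/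
theorem exists_goodFamily (h𝒞 : IsQuasiminimalPregeometryClass L 𝒞) (hH : 𝒞 H cl)
    (hH' : 𝒞 H' cl') :
    ∃ 𝔣 : Finset H → (H → H'),
      (∀ X : Finset H, ↑X ⊆ K.B → Disjoint (↑X : Set H) K.B₀ → K.GoodAt ↑X (𝔣 X)) ∧
      ∀ X Y : Finset H, ↑X ⊆ K.B → Disjoint (↑X : Set H) K.B₀ → Y ⊆ X →
        EqOn (𝔣 Y) (𝔣 X) (cl (K.B₀ ∪ ↑Y)) := by
  classical
  have hP := h𝒞.isPregeometry hH
  -- admissible finite sets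
  let Adm : Finset H → Prop := fun X => ↑X ⊆ K.B ∧ Disjoint (↑X : Set H) K.B₀
  have hAdm_mono : ∀ {X Y : Finset H}, Y ⊆ X → Adm X → Adm Y := fun hYX hX =>
    ⟨(Finset.coe_subset.2 hYX).trans hX.1, hX.2.mono_left (Finset.coe_subset.2 hYX)⟩
  have hAdm_empty : Adm ∅ := ⟨by simp, by simp⟩
  -- the invariant at stage `m`: good and coherent on admissible sets of size `≤ m`
  let Inv : ℕ → (Finset H → (H → H')) → Prop := fun m 𝔣 =>
    (∀ X, Adm X → X.card ≤ m → K.GoodAt ↑X (𝔣 X)) ∧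
      ∀ X, Adm X → X.card ≤ m → ∀ Y, Y ⊆ X → EqOn (𝔣 Y) (𝔣 X) (cl (K.B₀ ∪ ↑Y))
  have h0 : Inv 0 (fun _ => K.f₀) := by
    refine ⟨fun X _ hc => ?_, fun X _ _ Y _ => fun z _ => rfl⟩
    have : X = ∅ := Finset.card_eq_zero.1 (Nat.le_zero.1 hc)
    subst this
    rw [Finset.coe_empty]
    exact K.goodAt_empty h𝒞 hH
  have hstep : ∀ m 𝔣, Inv m 𝔣 → ∃ 𝔣', Inv (m + 1) 𝔣' ∧ ∀ X, X.card ≤ m → 𝔣' X = 𝔣 X := by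
    rintro m 𝔣 ⟨hg, hc⟩
    have hex : ∀ X : Finset H, ∃ f : H → H', Adm X → X.card = m + 1 →
        K.GoodAt ↑X f ∧ ∀ Y, Y ⊂ X → EqOn (𝔣 Y) f (cl (K.B₀ ∪ ↑Y)) := by
      intro X
      by_cases hX : Adm X ∧ X.card = m + 1
      · obtain ⟨hXadm, hXc⟩ := hX
        rcases Nat.lt_or_ge (m + 1) 2 with h1 | h2
        · obtain ⟨f, hf⟩ := K.exists_goodAt h𝒞 hH hH' X.finite_toSet hXadm.1 hXadm.2
          refine ⟨f, fun _ _ => ⟨hf, fun Y hY z hz => ?_⟩⟩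
          have hY0 : Y = ∅ := Finset.card_eq_zero.1 (by have := Finset.card_lt_card hY; omega)
          subst hY0
          have hz' : z ∈ cl K.B₀ := by simpa using hz
          rw [(hg ∅ hAdm_empty (by simp)).onB₀ hz', hf.onB₀ hz']
        · obtain ⟨f, hf, hfext⟩ := K.exists_goodAt_extend h𝒞 hH hH' hXadm.1 hXadm.2 (by omega) 𝔣
            (fun Y hY => hg Y (hAdm_mono hY.1 hXadm) (by have := Finset.card_lt_card hY; omega))
            (fun Y hY Z hZ => hc Y (hAdm_mono hY.1 hXadm)
              (by have := Finset.card_lt_card hY; omega) Z hZ)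
          exact ⟨f, fun _ _ => ⟨hf, hfext⟩⟩
      · exact ⟨K.f₀, fun h1 h2 => absurd ⟨h1, h2⟩ hX⟩
    choose fX hfX using hex
    let 𝔣' : Finset H → (H → H') := fun X => if Adm X ∧ X.card = m + 1 then fX X else 𝔣 X
    have hold : ∀ X, X.card ≤ m → 𝔣' X = 𝔣 X := fun X hX =>
      if_neg fun h => by omega
    have hnew : ∀ X, Adm X → X.card = m + 1 → 𝔣' X = fX X := fun X hX hXc => if_pos ⟨hX, hXc⟩
    refine ⟨𝔣', ⟨?_, ?_⟩, hold⟩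
    · intro X hX hcard
      rcases Nat.lt_or_ge X.card (m + 1) with hlt | hge
      · rw [hold X (by omega)]; exact hg X hX (by omega)
      · have hXc : X.card = m + 1 := by omega
        rw [hnew X hX hXc]; exact (hfX X hX hXc).1
    · intro X hX hcard Y hYX
      have hYc : Y.card ≤ X.card := Finset.card_le_card hYX
      rcases Nat.lt_or_ge X.card (m + 1) with hlt | hge
      · rw [hold X (by omega), hold Y (by omega)]
        exact hc X hX (by omega) Y hYX
      · have hXc : X.card = m + 1 := by omega
        by_cases hYeq : Y = X
        · subst hYeq; exact fun z _ => rfl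
        · have hss : Y ⊂ X := lt_of_le_of_ne hYX hYeq
          have hYc' : Y.card ≤ m := by have := Finset.card_lt_card hss; omega
          rw [hnew X hX hXc, hold Y hYc']
          exact (hfX X hX hXc).2 Y hss
  -- iterate the stages
  choose! next hnext using hstep
  let seq : ℕ → (Finset H → (H → H')) := fun m => Nat.rec (fun _ => K.f₀) (fun m 𝔣 => next m 𝔣) m
  have hseq_succ : ∀ m, seq (m + 1) = next m (seq m) := fun m => rfl
  have hInv : ∀ m, Inv m (seq m) := by
    intro m
    induction m with
    | zero => exact h0
    | succ m ih => rw [hseq_succ]; exact (hnext m _ ih).1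
  have hstable : ∀ {m m' : ℕ}, m ≤ m' → ∀ X : Finset H, X.card ≤ m → seq m' X = seq m X := by
    intro m m' hmm'
    induction hmm' with
    | refl => exact fun X _ => rfl
    | step hle ih =>
      intro X hX
      rw [hseq_succ, (hnext _ _ (hInv _)).2 X (hX.trans hle), ih X hX]
  refine ⟨fun X => seq X.card X, fun X hXB hXB₀ => (hInv X.card).1 X ⟨hXB, hXB₀⟩ le_rfl, ?_⟩
  intro X Y hXB hXB₀ hYX z hz
  show seq Y.card Y z = seq X.card X z
  rw [← hstable (Finset.card_le_card hYX) Y le_rfl]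
  exact (hInv X.card).2 X ⟨hXB, hXB₀⟩ le_rfl Y hYX hz

end KirbyData

/-! ### Kirby 2010, Theorem 3.3 / Haykazyan 2016, Theorem 16 -/

/-- **Bijections between bases extend to isomorphisms** (Kirby 2010, Thm 3.3 with `G = ∅`;
Haykazyan 2016, Thm 16; the excellence needed in Kirby's proof is BHHKK 2014, Prop. 6.2). Let
`⟨H, cl⟩, ⟨H', cl'⟩` be members of a quasiminimal pregeometry class, `B, B'` bases (independent
spanning sets) and `B ≃ B'` a bijection. Then there is an isomorphism of `L`-structures
`H ≃[L] H'` extending it. For countable `B` this is Thm 2.1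
(`exists_equiv_of_indepFamilies_countable`); for uncountable `B`, split off a countably infinite
`B₀ ⊆ B`, map `cl B₀` by Thm 2.1 (`f₀`), build the compatible closed embeddings
`f_X : cl (B₀ ∪ X) → H'` for finite `X ⊆ B ∖ B₀` (`KirbyData.exists_goodFamily`) and take their
union: it is defined everywhere and a partial embedding by finite character, and onto because its
image contains `cl' (e[B₀] ∪ e[X])` for every finite `X`.
[cite: Kirby2010QMEC, Thm 3.3] [cite: Haykazyan2016, Theorem 16] [cite: BHHKK2014, Thm 2.3] -/
theorem exists_equiv_extend_bases (h𝒞 : IsQuasiminimalPregeometryClass L 𝒞) (hH : 𝒞 H cl)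
    (hH' : 𝒞 H' cl') {B : Set H} {B' : Set H'} (hB : ClIndep cl B) (hBsp : cl B = univ)
    (hB' : ClIndep cl' B') (hB'sp : cl' B' = univ) (ebij : B ≃ B') :
    ∃ f : H ≃[L] H', ∀ b : B, f b = ebij b := by
  classical
  have hP := h𝒞.isPregeometry hH
  have hP' := h𝒞.isPregeometry hH'
  by_cases hBc : B.Countable
  · -- countable basis: Theorem 2.1
    haveI : Countable B := hBc.to_subtype
    have hu : IndepFamilyOver cl ∅ (fun b : B => (b : H)) :=
      hB.indepFamilyOver_empty hP Subtype.val_injective (fun b => b.2)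
    have hu' : IndepFamilyOver cl' ∅ (fun b : B => (ebij b : H')) :=
      hB'.indepFamilyOver_empty hP' (Subtype.val_injective.comp ebij.injective) (fun b => (ebij b).2)
    have hsp : cl (range fun b : B => (b : H)) = univ := by rw [Subtype.range_coe]; exact hBsp
    have hsp' : cl' (range fun b : B => (ebij b : H')) = univ := by
      have : range (fun b : B => (ebij b : H')) = B' := by
        ext y
        exact ⟨fun ⟨b, hb⟩ => hb ▸ (ebij b).2, fun hy => ⟨ebij.symm ⟨y, hy⟩, by simp⟩⟩
      rw [this]; exact hB'sp
    obtain ⟨f, hf⟩ := h𝒞.exists_equiv_of_indepFamilies_countable hH hH' hu hu' hsp hsp'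
    exact ⟨f, hf⟩
  · -- uncountable basis: Kirby's construction
    have hBinf : B.Infinite := fun h => hBc h.countable
    haveI : Infinite B := hBinf.to_subtype
    let uB : ℕ ↪ B := Infinite.natEmbedding B
    let u : ℕ → H := fun j => (uB j : H)
    have hu_inj : Function.Injective u := Subtype.val_injective.comp uB.injective
    have huB : ∀ j, u j ∈ B := fun j => (uB j).2
    obtain ⟨b₀, hb₀⟩ : B.Nonempty := hBinf.nonempty
    haveI : Nonempty H' := ⟨ebij ⟨b₀, hb₀⟩⟩
    let e : H → H' := fun z => if hz : z ∈ B then (ebij ⟨z, hz⟩ : H') else Classical.arbitrary H'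
    have he : ∀ (b : H) (hb : b ∈ B), e b = ebij ⟨b, hb⟩ := fun b hb => dif_pos hb
    have heB : ∀ b ∈ B, e b ∈ B' := fun b hb => by rw [he b hb]; exact (ebij _).2
    have heinj : InjOn e B := by
      intro a ha b hb hab
      rw [he a ha, he b hb] at hab
      have := ebij.injective (Subtype.ext hab)
      exact congr_arg Subtype.val this
    -- `f₀` by Theorem 2.1 over `∅`
    have hf : IsPartialEmbOn L e (∅ : Set H) :=
      IsPartialEmbOn.of_empty_iff.2 (h𝒞.eqQFType₂_elim0 hH hH')
    have hu0 : IndepFamilyOver cl ∅ u := hB.indepFamilyOver_empty hP hu_inj huB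
    have heu_inj : Function.Injective (fun j => e (u j)) := fun i j h =>
      hu_inj (heinj (huB i) (huB j) h)
    have hu0' : IndepFamilyOver cl' (e '' ∅) (fun j => e (u j)) := by
      rw [image_empty]
      exact hB'.indepFamilyOver_empty hP' heu_inj (fun j => heB _ (huB j))
    obtain ⟨f₀, hf₀, -, hf₀u, hf₀img⟩ := h𝒞.exists_isPartialEmbOn_extend_indepFamily hH hH'
      countable_empty (Or.inr rfl) hf hu0 hu0'
    rw [empty_union] at hf₀ hf₀img
    rw [image_empty, empty_union, show range (fun j => e (u j)) = e '' range u from range_comp e u]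
      at hf₀img
    let K : KirbyData L H H' cl cl' :=
      ⟨B, B', e, u, f₀, hB, hB', heB, heinj, hu_inj, huB, hf₀, hf₀img, hf₀u⟩
    obtain ⟨𝔣, hgood, hcoh⟩ := K.exists_goodFamily h𝒞 hH hH'
    have hB₀ : K.B₀ = range u := rfl
    have hB₀B : K.B₀ ⊆ B := by rw [hB₀]; rintro _ ⟨j, rfl⟩; exact huB j
    -- finite supports
    have hsupp : ∀ z : H, ∃ X : Finset H, ↑X ⊆ B ∧ Disjoint (↑X : Set H) K.B₀ ∧
        z ∈ cl (K.B₀ ∪ ↑X) := by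
      intro z
      have hz : z ∈ cl B := hBsp.symm ▸ mem_univ z
      obtain ⟨A, hAB, hAfin, hzA⟩ := hP.finite_character hz
      refine ⟨(hAfin.sdiff (t := K.B₀)).toFinset, ?_, ?_, ?_⟩
      · rw [Finite.coe_toFinset]; exact sdiff_subset.trans hAB
      · rw [Finite.coe_toFinset]; exact disjoint_sdiff_left
      · rw [Finite.coe_toFinset]
        refine hP.mono (fun y hy => ?_) hzA
        by_cases h : y ∈ K.B₀
        · exact Or.inl h
        · exact Or.inr ⟨hy, h⟩
    choose Xz hXzB hXzB₀ hzXz using hsupp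
    -- independence of the choice of support
    have hwd : ∀ (X X' : Finset H), ↑X ⊆ B → Disjoint (↑X : Set H) K.B₀ → ↑X' ⊆ B →
        Disjoint (↑X' : Set H) K.B₀ → ∀ z, z ∈ cl (K.B₀ ∪ ↑X) → z ∈ cl (K.B₀ ∪ ↑X') →
          𝔣 X z = 𝔣 X' z := by
      intro X X' hX hXd hX' hX'd z hz hz'
      have hU : (↑(X ∪ X') : Set H) ⊆ B ∧ Disjoint (↑(X ∪ X') : Set H) K.B₀ := by
        rw [Finset.coe_union]
        exact ⟨union_subset hX hX', disjoint_union_left.2 ⟨hXd, hX'd⟩⟩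
      rw [hcoh (X ∪ X') X hU.1 hU.2 Finset.subset_union_left hz,
        hcoh (X ∪ X') X' hU.1 hU.2 Finset.subset_union_right hz']
    let Φ : H → H' := fun z => 𝔣 (Xz z) z
    have hΦX : ∀ (X : Finset H), ↑X ⊆ B → Disjoint (↑X : Set H) K.B₀ → ∀ z ∈ cl (K.B₀ ∪ ↑X),
        Φ z = 𝔣 X z := fun X hX hXd z hz =>
      hwd _ _ (hXzB z) (hXzB₀ z) hX hXd z (hzXz z) hz
    -- `Φ` is a partial embedding everywhere
    have hΦ : IsPartialEmbOn L Φ univ := by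
      intro m t _
      let X : Finset H := Finset.univ.biUnion fun i => Xz (t i)
      have hXi : ∀ i, Xz (t i) ⊆ X := fun i => Finset.subset_biUnion_of_mem (fun i => Xz (t i))
        (Finset.mem_univ i)
      have hX : ↑X ⊆ B := by
        intro y hy
        obtain ⟨i, -, hi⟩ := Finset.mem_biUnion.1 (Finset.mem_coe.1 hy)
        exact hXzB (t i) hi
      have hXd : Disjoint (↑X : Set H) K.B₀ := by
        refine disjoint_left.2 fun y hy hyB₀ => ?_
        obtain ⟨i, -, hi⟩ := Finset.mem_biUnion.1 (Finset.mem_coe.1 hy)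
        exact (hXzB₀ (t i)).le_bot ⟨hi, hyB₀⟩
      have ht : ∀ i, t i ∈ cl (K.B₀ ∪ ↑X) := fun i =>
        hP.mono (union_subset_union_right _ (Finset.coe_subset.2 (hXi i))) (hzXz (t i))
      have e1 := (hgood X hX hXd).emb t ht
      have : Φ ∘ t = 𝔣 X ∘ t := funext fun i => hΦX X hX hXd _ (ht i)
      rw [this]
      exact e1
    -- `Φ` is onto
    have hΦsurj : Function.Surjective Φ := by
      intro y'
      have hy' : y' ∈ cl' B' := hB'sp.symm ▸ mem_univ y'
      obtain ⟨A', hA'B', hA'fin, hyA'⟩ := hP'.finite_character hy'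
      -- pull `A'` back to `B` along the bijection
      let S : Set B' := Subtype.val ⁻¹' A'
      have hSfin : S.Finite := hA'fin.preimage Subtype.val_injective.injOn
      let A : Set H := Subtype.val '' (ebij.symm '' S)
      have hAfin : A.Finite := (hSfin.image _).image _
      have hAB : A ⊆ B := by rintro _ ⟨b, -, rfl⟩; exact b.2
      have hA'A : A' ⊆ e '' A := by
        intro a' ha'
        refine ⟨(ebij.symm ⟨a', hA'B' ha'⟩ : H), ⟨ebij.symm ⟨a', hA'B' ha'⟩, ⟨⟨a', hA'B' ha'⟩, ha', rfl⟩, rfl⟩, ?_⟩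
        rw [he _ (ebij.symm ⟨a', hA'B' ha'⟩).2]
        simp
      let X : Finset H := (hAfin.sdiff (t := K.B₀)).toFinset
      have hXcoe : (↑X : Set H) = A \ K.B₀ := Finite.coe_toFinset _
      have hX : ↑X ⊆ B := by rw [hXcoe]; exact sdiff_subset.trans hAB
      have hXd : Disjoint (↑X : Set H) K.B₀ := by rw [hXcoe]; exact disjoint_sdiff_left
      have hAX : A ⊆ K.B₀ ∪ ↑X := fun y hy => by
        rw [hXcoe]
        by_cases h : y ∈ K.B₀
        · exact Or.inl h
        · exact Or.inr ⟨hy, h⟩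
      have hy'X : y' ∈ cl' (K.e '' (K.B₀ ∪ ↑X)) :=
        hP'.mono (hA'A.trans (image_mono hAX)) hyA'
      rw [← (hgood X hX hXd).img] at hy'X
      obtain ⟨z, hz, rfl⟩ := hy'X
      exact ⟨z, hΦX X hX hXd z hz⟩
    have hΦbij : Function.Bijective Φ :=
      ⟨fun a c hac => hΦ.injOn (mem_univ a) (mem_univ c) hac, hΦsurj⟩
    refine ⟨hΦ.toEquiv hΦbij, fun b => ?_⟩
    show Φ b = ebij b
    by_cases hb₀ : (b : H) ∈ K.B₀
    · have hbcl : (b : H) ∈ cl (K.B₀ ∪ ↑(∅ : Finset H)) := by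
        rw [Finset.coe_empty, union_empty]; exact hP.subset_cl _ hb₀
      rw [hΦX ∅ (by simp) (by simp) _ hbcl, (hgood ∅ (by simp) (by simp)).onB₀
        (by rw [Finset.coe_empty, union_empty] at hbcl; exact hbcl)]
      obtain ⟨j, hj⟩ := hb₀
      show f₀ b = ebij b
      rw [← hj, hf₀u j, he _ (huB j)]
      congr 1
      exact congr_arg ebij (Subtype.ext hj)
    · have hbX : (↑({(b : H)} : Finset H) : Set H) ⊆ B := by simp
      have hbd : Disjoint (↑({(b : H)} : Finset H) : Set H) K.B₀ := by simpa using hb₀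
      have hbcl : (b : H) ∈ cl (K.B₀ ∪ ↑({(b : H)} : Finset H)) :=
        hP.subset_cl _ (Or.inr (by simp))
      rw [hΦX _ hbX hbd _ hbcl, (hgood _ hbX hbd).onX b (by simp)]
      show e b = ebij b
      rw [he b b.2]

/-- **Categoricity in every uncountable cardinality** (Kirby 2010, Cor. 3.4; Haykazyan 2016,
§1: "two structures in a quasiminimal pregeometry class of the same uncountable cardinality are
isomorphic"; Bays–Hart–Hyttinen–Kesälä–Kirby 2014, Thm 2.3): members `H, H'` of a quasiminimal
pregeometry class with `#H = #H'` uncountable are isomorphic — `nonempty_equiv_of_mk_eq` with its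
hypothesis `h16` discharged by `exists_equiv_extend_bases`.
[cite: Kirby2010QMEC, Cor. 3.4] [cite: Haykazyan2016, Theorem 16] -/
theorem nonempty_equiv_of_mk_eq' (h𝒞 : IsQuasiminimalPregeometryClass L 𝒞) (hH : 𝒞 H cl)
    (hH' : 𝒞 H' cl') [Uncountable H] (hcard : #H = #H') : Nonempty (H ≃[L] H') :=
  h𝒞.nonempty_equiv_of_mk_eq
    (fun hK hK' _ _ _ _ hB hBsp hB' hB'sp e => h𝒞.exists_equiv_extend_bases hK hK' hB hBsp hB' hB'sp e)
    hH hH' hcard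

end IsQuasiminimalPregeometryClass

end Literature.ModelTheory.Quasiminimal

end
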